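import Summits.CriticalPhenomena.PercolationContinuityZ3.Theorems.Transplant.SkelNegBParamsBridgeF
import Summits.CriticalPhenomena.PercolationContinuityZ3.Theorems.Transplant.SkelNegBParamsResiduals2
import HarnessLib

/-!
# N1 params, chain of record `NegB`, part SlotsF: THE BOX RESIDUAL CARRYING THE WIDE y′-FACE BRIDGE — `S_F := nBF + ℓBF + |hBF|`,
# `gxF c := max gxR2 (64·S_F)` and the floors `64·S_R ≤ M_L`, `64·S_F ≤ M_L`, `16·S_F ≤ M_L` at `g := gT mk (gxF c)` (stmt-g15 2026-08-22; (L-F1) menu (ii)/(iii):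
# the Λ-bounds of the y′-face origin at the F-pair need `16·S_F ≤ M_L` exactly as `abs_Λof_yLof_le` needs `16·S ≤ M_L`, and the (R) y-leg keeps its `64·S_R ≤ M_L`)
The tuple's box residual becomes `gx := gxF c` (≥ `gxR2`); (C) is general in `gx`, Geom in every slot, and the (R) wrapper at `gx := gxF` is
`rootOblTWAt_negBT_y_exR2`'s `hS64` by `SF_floor.1` (p3, one line).
builds on p205010 (kernel theorem, internal audit signed; external expert review pending) — nothing in this file uses p205010; NOTHING is claimed about
the node `SamePDropOfSkeletonNeg₁` (OPEN; (F) blocked on `hlin` for the closure of record, lead g7 RULING E2; B.19 under refutation).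
Lane `prim-bschramm-*`, seat `prim-bschramm-stmt` (gen 15); helper file (`--supports stmt-CriticalPhenomena-4575 --as helper`); ledger HOME/prim-bschramm-stmt/NEG-PARAMS.md.
* `KS.SF`, **`KS.gxF`**, **`SF_floor`**.
[cite: KozmaNitzan2024, §4 Lemma 11 (pp. 22–23)] [cite: MartineauTassion2017, §3.2 Lemma 3.5]
-/

noncomputable section

open scoped Classical

namespace Summit.CriticalPhenomena.PercolationContinuityZ3.Theorems.Transplant

namespace PlanarSkeletonNeg

namespace NegB

open Literature.Probability.Percolation Literature.Probability.LatticeModels SimpleGraph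
open SkelConc (Consts)
open Skelφ.StepI (DataN)
open Neg

namespace KS

section SlotsF

variable (κ : Consts) {V : Type} [DecidableEq V] [Countable V] {G : SimpleGraph V} [G.LocallyFinite] (Φ : PlanarSkeletonNeg G) (t : V)
  (p : unitInterval) (D : DataN V) (c mk : ℕ)

/-- **The wide bridge's size** `S_F := nBF + ℓBF + |hBF|`. [this work] -/
def SF : ℕ := nBF κ Φ t p D c mk + ℓBF κ Φ t p D c mk + (hBF κ Φ t p D c mk).natAbs

end SlotsF

/-- **THE BOX RESIDUAL CARRYING BOTH BRIDGES** `gxF c := max gxR2 (64·S_F)` (kit index `0` for the sizes, as `gxR2`). [this work] -/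
def gxF (c : ℕ) : Neg.FSlot := fun κ _ _ _ _ _ Φ t p D => max (gxR2 κ Φ t p D) (64 * SF κ Φ t p D c 0)

section Floors

variable (κ : Consts) {V : Type} [DecidableEq V] [Countable V] {G : SimpleGraph V} [G.LocallyFinite] (Φ : PlanarSkeletonNeg G) (t : V)
  (p : unitInterval) (D : DataN V) (c mk : ℕ)

/-- **The floors at `g := gT mk (gxF c)`**: `64·(n_b + ℓ_b + |h_b|) ≤ M_L` (the (R) y-leg's), `64·S_F ≤ M_L` and `16·S_F ≤ M_L` (the y′-face origin's Λ-bounds). [folklore] -/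
theorem SF_floor : 64 * (nBR κ Φ t p D 0 + ℓBR κ Φ t p D 0 + (hBR κ Φ t p D 0).natAbs) ≤ ML κ Φ t p D (gT mk (gxF c) κ Φ t p D) ∧
    64 * SF κ Φ t p D c 0 ≤ ML κ Φ t p D (gT mk (gxF c) κ Φ t p D) ∧ 16 * SF κ Φ t p D c 0 ≤ ML κ Φ t p D (gT mk (gxF c) κ Φ t p D) := by
  have h1 := (gT_floors κ Φ t p D mk (gxF c)).2.2.2
  have h2 := (ML_le_ML κ Φ t p D (gT mk (gxF c) κ Φ t p D)).2
  have e : gxF c κ Φ t p D = max (64 * (nBR κ Φ t p D 0 + ℓBR κ Φ t p D 0 + (hBR κ Φ t p D 0).natAbs)) (64 * SF κ Φ t p D c 0) := rfl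
  rw [e] at h1
  have a := le_trans (le_max_left _ _) (h1.trans h2)
  have b := le_trans (le_max_right _ _) (h1.trans h2)
  exact ⟨a, b, by omega⟩

end Floors

end KS

end NegB

end PlanarSkeletonNeg

end Summit.CriticalPhenomena.PercolationContinuityZ3.Theorems.Transplant

end
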